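import Summits.ValiantsHypothesis.ValiantsHypothesis.Theses.RyserTripartition
import Literature.Computability.AlgebraicComplexity.ArithCircuitProofs

/-!
# ValiantsHypothesis / RyserTripartition — item `HostageGlue` (stmt-ValiantsHypothesis-7164)

`PerLeTripartition → MultilinearRyserOptimal → TripartitionHard` (pure asymptotics): `L(T_k)` is
attained by a fan-in-two circuit `Γ` (`ArithCircuit.exists_computes_size_eq_complexity`); the bridge
gives a syntactically multilinear circuit for `per_{3k}` of size `≤ c|Γ| + c(k+1)^c·C(3k,k)`;
multilinear Ryser-optimality at `n = 3k` with `ε'/2` gives `8^{(1-ε'/2)k} ≤` that size; and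
`C(3k,k) ≤ (27/4)^k` (from `C(3k,k)·k^k·(2k)^{2k} ≤ (3k)^{3k}`) with `27/4 < 7 ≤ 8^{1-ε'/2}` for
`ε' ≤ 1/20` absorbs the additive term for large `k`; monotonicity in `ε` does the rest.
HONEST FRAMING: bookkeeping over OPEN cruxes of a dormant route; nothing here is progress on
`VP ≠ VNP`.
-/

-- layout Summits/ValiantsHypothesis/ValiantsHypothesis forces the duplicated namespace component
set_option linter.dupNamespace false

namespace Summit.ValiantsHypothesis.ValiantsHypothesis.Theorems.RyserTripartition

open Literature.Computability.AlgebraicComplexity Filter Finset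

/-- `4^k · C(3k,k) ≤ 27^k` (the term `j = k` of `(k + 2k)^{3k} = Σ_j C(3k,j) k^j (2k)^{3k-j}`).
[folklore] -/
theorem four_pow_mul_choose_le (k : ℕ) : 4 ^ k * Nat.choose (3 * k) k ≤ 27 ^ k := by
  rcases Nat.eq_zero_or_pos k with rfl | hk
  · simp
  -- the binomial term
  have hterm : k ^ k * (2 * k) ^ (3 * k - k) * Nat.choose (3 * k) k ≤ (k + 2 * k) ^ (3 * k) := by
    rw [add_pow]
    exact Finset.single_le_sum (f := fun m => k ^ m * (2 * k) ^ (3 * k - m) * Nat.choose (3 * k) m)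
      (fun _ _ => Nat.zero_le _) (Finset.mem_range.2 (by omega))
  have h1 : (k + 2 * k) ^ (3 * k) = 27 ^ k * k ^ (3 * k) := by
    rw [show k + 2 * k = 3 * k by ring, mul_pow, pow_mul]; norm_num
  have h2 : k ^ k * (2 * k) ^ (3 * k - k) = 4 ^ k * k ^ (3 * k) := by
    rw [show 3 * k - k = 2 * k by omega, mul_pow, pow_mul, pow_mul]
    norm_num
    ring
  rw [h1, h2, mul_assoc, mul_comm (k ^ (3 * k)), ← mul_assoc] at hterm
  exact Nat.le_of_mul_le_mul_right hterm (pow_pos hk _)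

/-- `7 ≤ 8^{1 - ε/2}` for `ε ≤ 1/20` (`7^40 ≤ 8^39`). [folklore] -/
theorem seven_le_eight_rpow {ε : ℝ} (hε : ε ≤ 1 / 20) : (7 : ℝ) ≤ (8 : ℝ) ^ (1 - ε / 2) := by
  have h1 : (8 : ℝ) ^ ((39 : ℝ) / 40) ≤ (8 : ℝ) ^ (1 - ε / 2) :=
    Real.rpow_le_rpow_of_exponent_le (by norm_num) (by linarith)
  refine le_trans ?_ h1
  -- `7 = (7^40)^{1/40} ≤ (8^39)^{1/40} = 8^{39/40}`
  have h740 : ((7 : ℝ) ^ (40 : ℕ)) ^ ((40 : ℕ)⁻¹ : ℝ) = 7 := Real.pow_rpow_inv_natCast (by norm_num) (by norm_num)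
  have h839 : (8 : ℝ) ^ ((39 : ℝ) / 40) = ((8 : ℝ) ^ (39 : ℕ)) ^ ((40 : ℕ)⁻¹ : ℝ) := by
    rw [← Real.rpow_natCast, ← Real.rpow_mul (by norm_num)]
    norm_num
  rw [← h740, h839]
  exact Real.rpow_le_rpow (by positivity) (by norm_num) (by positivity)

/-- **Item `HostageGlue` (stmt-ValiantsHypothesis-7164):**
`PerLeTripartition → MultilinearRyserOptimal → TripartitionHard`. [folklore] -/
theorem hostageGlue_proof : Theses.RyserTripartition.HostageGlue := by
  unfold Theses.RyserTripartition.HostageGlue Theses.RyserTripartition.PerLeTripartition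
    Theses.RyserTripartition.MultilinearRyserOptimal Theses.RyserTripartition.TripartitionHard
  rintro ⟨c, hc⟩ hM ε hε
  -- shrink `ε`
  set ε' : ℝ := min ε (1 / 20) with hε'def
  have hε'pos : 0 < ε' := lt_min hε (by norm_num)
  have hε'le : ε' ≤ ε := min_le_left _ _
  have hε'20 : ε' ≤ 1 / 20 := min_le_right _ _
  obtain ⟨n₀, hn₀⟩ := hM (ε' / 2) (by positivity)
  -- eventual conditions in `k`
  have hb : 1 < (8 : ℝ) ^ (ε' / 2) := Real.one_lt_rpow (by norm_num) (by positivity)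
  have hE1 : ∀ᶠ k : ℕ in atTop, 2 * (c : ℝ) ≤ ((8 : ℝ) ^ (ε' / 2)) ^ k :=
    (tendsto_pow_atTop_atTop_of_one_lt hb).eventually_ge_atTop _
  have hr : |(27 / 28 : ℝ)| < 1 := by rw [abs_of_pos (by norm_num)]; norm_num
  have hE2 : ∀ᶠ k : ℕ in atTop, (k : ℝ) ^ c * (27 / 28 : ℝ) ^ k ≤ 1 / (2 * c * 2 ^ c + 1) :=
    (tendsto_pow_const_mul_const_pow_of_abs_lt_one c hr).eventually_le_const (by positivity)
  obtain ⟨K, hK⟩ := eventually_atTop.1 (hE1.and (hE2.and (eventually_ge_atTop (max n₀ 1))))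
  refine ⟨K, fun k hk => ?_⟩
  obtain ⟨h1k, h2k, h3k⟩ := hK k hk
  have hk1 : 1 ≤ k := (le_max_right _ _).trans h3k
  have hkn₀ : n₀ ≤ 3 * k := ((le_max_left _ _).trans h3k).trans (by omega)
  -- the circuit attaining `L(T_k)` and the bridge
  set Tk := (∑ S : {A : Finset (Fin (3 * k)) // A.card = k}, ∑ T : {A : Finset (Fin (3 * k)) // A.card = k},
    ∑ U : {A : Finset (Fin (3 * k)) // A.card = k},
      if Disjoint S.1 T.1 ∧ Disjoint S.1 U.1 ∧ Disjoint T.1 U.1 then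
        (MvPolynomial.X (0, S) * MvPolynomial.X (1, T) * MvPolynomial.X (2, U) :
          MvPolynomial (Fin 3 × {A : Finset (Fin (3 * k)) // A.card = k}) ℂ) else 0) with hTk
  obtain ⟨Γ, hΓ2, hΓc, hΓsize⟩ := ArithCircuit.exists_computes_size_eq_complexity Tk
  obtain ⟨P, hP2, hPsm, hPc, hPsize⟩ := hc k Γ ⟨hΓ2, hΓc⟩
  have hlow := hn₀ (3 * k) hkn₀ P ⟨hP2, hPsm, hPc⟩
  -- real-number bookkeeping
  have h8pos : (0 : ℝ) < 8 := by norm_num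
  have hsizeR : (P.size : ℝ) ≤ c * Γ.size + c * ((k : ℝ) + 1) ^ c * (Nat.choose (3 * k) k : ℝ) := by
    exact_mod_cast hPsize
  have hlow' : (8 : ℝ) ^ ((1 - ε' / 2) * (k : ℝ)) ≤ (P.size : ℝ) := by
    have : (2 : ℝ) ^ ((1 - ε' / 2) * ((3 * k : ℕ) : ℝ)) = (8 : ℝ) ^ ((1 - ε' / 2) * (k : ℝ)) := by
      rw [show ((3 * k : ℕ) : ℝ) = (3 : ℕ) * (k : ℝ) by push_cast; ring,
        show (1 - ε' / 2) * ((3 : ℕ) * (k : ℝ)) = (3 : ℕ) * ((1 - ε' / 2) * (k : ℝ)) by ring,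
        Real.rpow_natCast_mul (by norm_num)]
      norm_num
    rw [← this]; exact hlow
  -- (A) the main term: `c · 8^{(1-ε')k} ≤ ½ · 8^{(1-ε'/2)k}`
  have hsplit : (8 : ℝ) ^ ((1 - ε' / 2) * (k : ℝ)) =
      (8 : ℝ) ^ ((1 - ε') * (k : ℝ)) * ((8 : ℝ) ^ (ε' / 2)) ^ k := by
    rw [← Real.rpow_mul_natCast h8pos.le, ← Real.rpow_add h8pos]; ring_nf
  have hA : (c : ℝ) * (8 : ℝ) ^ ((1 - ε') * (k : ℝ)) ≤ 1 / 2 * (8 : ℝ) ^ ((1 - ε' / 2) * (k : ℝ)) := by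
    rw [hsplit]
    have h0 : (0 : ℝ) ≤ (8 : ℝ) ^ ((1 - ε') * (k : ℝ)) := Real.rpow_nonneg h8pos.le _
    nlinarith
  -- (B) the additive term: `c (k+1)^c C(3k,k) ≤ ½ · 8^{(1-ε'/2)k}`
  have hchoose : (Nat.choose (3 * k) k : ℝ) ≤ (27 / 4 : ℝ) ^ k := by
    have h := four_pow_mul_choose_le k
    have h' : (4 : ℝ) ^ k * (Nat.choose (3 * k) k : ℝ) ≤ (27 : ℝ) ^ k := by exact_mod_cast h
    rw [div_pow, le_div_iff₀ (by positivity)]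
    linarith
  have hk1R : (1 : ℝ) ≤ k := by exact_mod_cast hk1
  have hsucc : ((k : ℝ) + 1) ^ c ≤ 2 ^ c * (k : ℝ) ^ c := by
    rw [← mul_pow]; exact pow_le_pow_left₀ (by positivity) (by linarith) c
  have h7 : (7 : ℝ) ^ k ≤ (8 : ℝ) ^ ((1 - ε' / 2) * (k : ℝ)) := by
    rw [Real.rpow_mul_natCast h8pos.le]
    exact pow_le_pow_left₀ (by norm_num) (seven_le_eight_rpow hε'20) k
  have hB : (c : ℝ) * ((k : ℝ) + 1) ^ c * (Nat.choose (3 * k) k : ℝ) ≤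
      1 / 2 * (8 : ℝ) ^ ((1 - ε' / 2) * (k : ℝ)) := by
    have hc0 : (0 : ℝ) ≤ c := Nat.cast_nonneg c
    -- `c (k+1)^c C(3k,k) ≤ c 2^c k^c (27/28)^k 7^k ≤ ½ 7^k`
    have e1 : (c : ℝ) * ((k : ℝ) + 1) ^ c * (Nat.choose (3 * k) k : ℝ) ≤
        (c * 2 ^ c) * ((k : ℝ) ^ c * (27 / 28 : ℝ) ^ k) * (7 : ℝ) ^ k := by
      have : (27 / 4 : ℝ) ^ k = (27 / 28 : ℝ) ^ k * (7 : ℝ) ^ k := by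
        rw [← mul_pow]; norm_num
      calc (c : ℝ) * ((k : ℝ) + 1) ^ c * (Nat.choose (3 * k) k : ℝ)
          ≤ (c : ℝ) * (2 ^ c * (k : ℝ) ^ c) * (27 / 4 : ℝ) ^ k := by
            apply mul_le_mul (mul_le_mul_of_nonneg_left hsucc hc0) hchoose (by positivity)
              (by positivity)
        _ = (c * 2 ^ c) * ((k : ℝ) ^ c * (27 / 28 : ℝ) ^ k) * (7 : ℝ) ^ k := by rw [this]; ring
    have e2 : (c * 2 ^ c : ℝ) * ((k : ℝ) ^ c * (27 / 28 : ℝ) ^ k) ≤ 1 / 2 := by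
      have hden : (0 : ℝ) < 2 * c * 2 ^ c + 1 := by positivity
      calc (c * 2 ^ c : ℝ) * ((k : ℝ) ^ c * (27 / 28 : ℝ) ^ k)
          ≤ (c * 2 ^ c : ℝ) * (1 / (2 * c * 2 ^ c + 1)) :=
            mul_le_mul_of_nonneg_left h2k (by positivity)
        _ ≤ 1 / 2 := by
            rw [mul_one_div, div_le_iff₀ hden]; nlinarith
    calc (c : ℝ) * ((k : ℝ) + 1) ^ c * (Nat.choose (3 * k) k : ℝ)
        ≤ (c * 2 ^ c) * ((k : ℝ) ^ c * (27 / 28 : ℝ) ^ k) * (7 : ℝ) ^ k := e1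
      _ ≤ 1 / 2 * (7 : ℝ) ^ k := mul_le_mul_of_nonneg_right e2 (by positivity)
      _ ≤ 1 / 2 * (8 : ℝ) ^ ((1 - ε' / 2) * (k : ℝ)) := by linarith
  -- combine: `c · L(T_k) ≥ c · 8^{(1-ε')k}`
  have hmain : (c : ℝ) * (8 : ℝ) ^ ((1 - ε') * (k : ℝ)) ≤ c * (Γ.size : ℝ) := by linarith
  have hmono : (8 : ℝ) ^ ((1 - ε) * (k : ℝ)) ≤ (8 : ℝ) ^ ((1 - ε') * (k : ℝ)) :=
    Real.rpow_le_rpow_of_exponent_le (by norm_num)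
      (mul_le_mul_of_nonneg_right (by linarith) (Nat.cast_nonneg k))
  rcases Nat.eq_zero_or_pos c with hc0 | hcpos
  · -- `c = 0`: the bridge circuit would have size `0 < 8^{…}`, absurd
    exfalso
    subst hc0
    have : (8 : ℝ) ^ ((1 - ε' / 2) * (k : ℝ)) ≤ 0 := by simpa using hlow'.trans hsizeR
    exact absurd this (not_le.2 (Real.rpow_pos_of_pos h8pos _))
  · have hcR : (0 : ℝ) < c := by exact_mod_cast hcpos
    rw [← hΓsize]
    exact hmono.trans (le_of_mul_le_mul_left hmain hcR)

end Summit.ValiantsHypothesis.ValiantsHypothesis.Theorems.RyserTripartition
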